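import Literature.Topology.FourManifolds.CreaseBandReading
import Literature.Topology.FourManifolds.CreaseStage
import Literature.Topology.FourManifolds.BandFrame
import HarnessLib

/-!
# A vertex reads a shell point: the three readability data (band and sector cases)

Topic `Literature/Topology/FourManifolds`; the band case of the vertex stage of the smoothing
sweep (Munkres, Ann. of Math. 72 (1960), §5; Campbell–D'Onofrio–Vítek (2026), Lemma 3.2),
packaging `CreaseBandReading.lean` for the concrete shape met in the sweep.  Near a band point
`z = z₁ + y` of the vertex chart the current map is `Φ' ∘ g ∘ Φ` — `Φ` (first chart into the
crease coordinates `E' × ℝ`), the crease map `g` with its record at `Φ z`, and `Φ'` (crease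
coordinates to the second chart) — and the vertex reads `N (x, y') = Φ' (g (Φ (z₁ + y'))) - z₂`
over a zero-dimensional base `E`.

* `bandPoint_readable` — from pointwise data at `z` (smoothness of `Φ`, `Φ'`, `g`; lower and
  upper bounds `aΦ, MΦ` of `DΦ(z)`, `aΦ', MΦ'` of `DΦ'`; the record `(ε, a₀, A₀, C₀)` of `Dg(Φ z)`
  with `ε κ < 1`, `κ = 1 + (C₀+1)/a₀`; the Lipschitz and displacement bounds `L' ε`, `MΦ' ε` of
  `Φ'` between `g (Φ z)` and `Φ z`; the reference defect `η₀ ‖y‖` of `Φ' ∘ Φ`; and the tangency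
  bound `σ` of the normal component of `DΦ(z) y`) the three inputs of
  `shellPointReadable_of_bounds_subsingleton`: `N` is `C^∞` at `q = (x, y)`, the fibre derivative
  is bounded below by `m ‖w‖` with `m = aΦ' ((1 - ε κ)/κ) aΦ`, and the Euler defect is at most
  `η ‖y‖` with the explicit `η` of `norm_fderiv_band_sub_le_mul`.

* `sectorPoint_readable` — the sector case: near `z` the current map is a `C^∞` map `G` with
  `G z₁ = z₂`, derivative bounded below by `m ‖w‖` and quadratic Euler defect `κ ‖z - z₁‖²`
  (`SectorBounds.lean`); then `N` is `C^∞` at `q`, the fibre bound is `m`, and the defect is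
  `(κ r) ‖y‖` on the shell `‖y‖ ≤ r`.

Everything is proved; no definitions; no named facts.

## References

* J. R. Munkres, *Obstructions to the smoothing of piecewise-differentiable homeomorphisms*, Ann.
  of Math. (2) 72 (1960), 521–554, §5. [Munkres1960]
* D. Campbell, L. D'Onofrio, T. Vítek, *Diffeomorphic approximation of piecewise affine
  homeomorphisms*, J. Geom. Anal. 36 (2026), Lemma 3.2. [CampbellDonofrioVitek2026]
-/

noncomputable section

open Set Function Metric Filter
open scoped Topology ContDiff

namespace Literature.Topology.FourManifolds

variable {E : Type*} [NormedAddCommGroup E] [NormedSpace ℝ E] [Subsingleton E]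
variable {F : Type*} [NormedAddCommGroup F] [NormedSpace ℝ F]
variable {E' : Type*} [NormedAddCommGroup E'] [NormedSpace ℝ E']

/-- **A vertex reads a band point** (see the module docstring). [cite: CampbellDonofrioVitek2026, Lemma 3.2] -/
theorem bandPoint_readable {Φ : F → E' × ℝ} {Φ' : E' × ℝ → F} {g : E' × ℝ → E' × ℝ}
    {N : E × F → F} {z₁ z₂ : F} {q : E × F}
    (hNev : N =ᶠ[𝓝 q] fun p => Φ' (g (Φ (z₁ + p.2))) - z₂)
    (hΦ : ContDiffAt ℝ ∞ Φ (z₁ + q.2)) (hg : ContDiff ℝ ∞ g)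
    (hΦ' : ContDiffAt ℝ ∞ Φ' (g (Φ (z₁ + q.2)))) (hΦ'₀ : DifferentiableAt ℝ Φ' (Φ (z₁ + q.2)))
    {r aΦ MΦ aΦ' MΦ' ε a₀ A₀ C₀ L' η₀ σ : ℝ} (hr : 0 < r) (hq : r / 4 ≤ ‖q.2‖)
    (haΦ : ∀ w : F, aΦ * ‖w‖ ≤ ‖fderiv ℝ Φ (z₁ + q.2) w‖)
    (hMΦ : ‖fderiv ℝ Φ (z₁ + q.2)‖ ≤ MΦ)
    (haΦ'0 : 0 < aΦ') (haΦ' : ∀ u : E' × ℝ, aΦ' * ‖u‖ ≤ ‖fderiv ℝ Φ' (g (Φ (z₁ + q.2))) u‖)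
    (hMΦ'0 : 0 ≤ MΦ') (hMΦ' : ‖fderiv ℝ Φ' (Φ (z₁ + q.2))‖ ≤ MΦ')
    (hε0 : 0 ≤ ε) (ha₀ : 0 < a₀)
    (hgface : ∀ v : E', ‖fderiv ℝ g (Φ (z₁ + q.2)) (v, 0) - (v, 0)‖ ≤ ε * ‖v‖)
    (hga : a₀ ≤ (fderiv ℝ g (Φ (z₁ + q.2)) (0, 1)).2)
    (hgA : (fderiv ℝ g (Φ (z₁ + q.2)) (0, 1)).2 ≤ A₀)
    (hgC : ‖(fderiv ℝ g (Φ (z₁ + q.2)) (0, 1)).1‖ ≤ C₀)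
    (hsmall : ε * (1 + (C₀ + 1) / a₀) < 1)
    (hL'0 : 0 ≤ L')
    (hL' : ‖fderiv ℝ Φ' (g (Φ (z₁ + q.2))) - fderiv ℝ Φ' (Φ (z₁ + q.2))‖ ≤ L' * ε)
    (hΔ : ‖Φ' (g (Φ (z₁ + q.2))) - Φ' (Φ (z₁ + q.2))‖ ≤ MΦ' * ε)
    (hη₀ : ‖fderiv ℝ Φ' (Φ (z₁ + q.2)) (fderiv ℝ Φ (z₁ + q.2) q.2) -
      (Φ' (Φ (z₁ + q.2)) - z₂)‖ ≤ η₀ * ‖q.2‖)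
    (hσ0 : 0 ≤ σ) (hσ : |(fderiv ℝ Φ (z₁ + q.2) q.2).2| ≤ σ) :
    ContDiffAt ℝ ∞ N q ∧
      (∀ w : F, aΦ' * ((1 - ε * (1 + (C₀ + 1) / a₀)) / (1 + (C₀ + 1) / a₀)) * aΦ * ‖w‖ ≤
        ‖fderiv ℝ N q (0, w)‖) ∧
      ‖fderiv ℝ N q (0, q.2) - N q‖ ≤
        (η₀ + L' * ε * (1 + ε + C₀ + |A₀|) * MΦ + MΦ' * ε * MΦ +
          4 / r * (MΦ' * (C₀ + |A₀| + 1) * σ + MΦ' * ε)) * ‖q.2‖ := by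
  -- the maps of `CreaseBandReading`
  set A : E × F → E' × ℝ := fun p => Φ (z₁ + p.2) with hA
  set A' : E' × ℝ → E × F := fun u => (q.1, Φ' u) with hA'
  have hNev' : N =ᶠ[𝓝 q] fun p => (A' (g (A p))).2 - z₂ := by
    filter_upwards [hNev] with p hp; simpa [hA, hA'] using hp
  -- derivatives of `A`, `A'`
  have hshift : ∀ p : E × F, HasFDerivAt (fun p : E × F => z₁ + p.2) (ContinuousLinearMap.snd ℝ E F) p :=
    fun p => ((ContinuousLinearMap.snd ℝ E F).hasFDerivAt).const_add z₁
  have hAq : A q = Φ (z₁ + q.2) := rfl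
  have hAdiff : DifferentiableAt ℝ A q :=
    (hΦ.differentiableAt (by simp)).comp q (hshift q).differentiableAt
  have hfA : fderiv ℝ A q = (fderiv ℝ Φ (z₁ + q.2)).comp (ContinuousLinearMap.snd ℝ E F) :=
    ((hΦ.differentiableAt (by simp)).hasFDerivAt.comp q (hshift q)).fderiv
  have hfA_apply : ∀ d : E × F, fderiv ℝ A q d = fderiv ℝ Φ (z₁ + q.2) d.2 := fun d => by
    rw [hfA]; rfl
  have hA'diff : ∀ u, DifferentiableAt ℝ Φ' u → DifferentiableAt ℝ A' u := fun u hu =>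
    (differentiableAt_const _).prodMk hu
  have hfA' : ∀ u, DifferentiableAt ℝ Φ' u →
      fderiv ℝ A' u = (ContinuousLinearMap.inr ℝ E F).comp (fderiv ℝ Φ' u) := fun u hu => by
    have := ((hasFDerivAt_const q.1 u).prodMk hu.hasFDerivAt).fderiv
    rw [show A' = fun u => (q.1, Φ' u) from rfl, this]
    ext v <;> simp
  have hfA'_apply : ∀ u, DifferentiableAt ℝ Φ' u → ∀ v, fderiv ℝ A' u v = (q.1, fderiv ℝ Φ' u v) :=
    fun u hu v => by rw [hfA' u hu]; exact Prod.ext (Subsingleton.elim _ _) rfl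
  have hnormA' : ∀ u, DifferentiableAt ℝ Φ' u → ∀ v, ‖fderiv ℝ A' u v‖ = ‖fderiv ℝ Φ' u v‖ :=
    fun u hu v => by
      rw [hfA'_apply u hu v, ← norm_snd_eq_norm_of_subsingleton]
  have hgdiff : DifferentiableAt ℝ g (A q) := (hg.differentiable (by simp)) _
  have hΦ'diff : DifferentiableAt ℝ Φ' (g (A q)) := hΦ'.differentiableAt (by simp)
  -- ### (i) smoothness
  have hsmooth : ContDiffAt ℝ ∞ N q := by
    have h1 : ContDiffAt ℝ ∞ (fun p : E × F => Φ (z₁ + p.2)) q :=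
      hΦ.comp q (contDiffAt_const.add contDiffAt_snd)
    have h2 : ContDiffAt ℝ ∞ (fun p : E × F => Φ' (g (Φ (z₁ + p.2)))) q :=
      hΦ'.comp q (hg.contDiffAt.comp q h1)
    exact (h2.sub contDiffAt_const).congr_of_eventuallyEq hNev
  -- ### (ii) fibre lower bound
  have hC₀ : 0 ≤ C₀ := (norm_nonneg _).trans hgC
  set κ : ℝ := 1 + (C₀ + 1) / a₀ with hκ
  have hκ0 : 0 < κ := by
    have : 0 < (C₀ + 1) / a₀ := div_pos (by linarith) ha₀
    rw [hκ]; linarith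
  have hag : ∀ u : E' × ℝ, (1 - ε * κ) / κ * ‖u‖ ≤ ‖fderiv ℝ g (A q) u‖ := by
    intro u
    have h := norm_le_of_face_normal_bounds (T := fderiv ℝ g (A q)) ha₀ hε0 hgface hga hgC u
    rw [div_mul_eq_mul_div, div_le_iff₀ hκ0]
    linarith
  have hag0 : 0 ≤ (1 - ε * κ) / κ := div_nonneg (by linarith) hκ0.le
  have hfib : ∀ w : F, aΦ' * ((1 - ε * κ) / κ) * aΦ * ‖w‖ ≤ ‖fderiv ℝ N q (0, w)‖ := by
    intro w
    refine norm_fderiv_band_ge hNev' hAdiff hgdiff (hA'diff _ hΦ'diff) hag0 haΦ'0.le ?_ hag ?_ w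
    · intro w'; rw [hfA_apply]; exact haΦ w'
    · intro u; rw [hnormA' _ hΦ'diff]; exact haΦ' u
  -- ### (iii) Euler defect
  have hGg : ‖fderiv ℝ g (A q)‖ ≤ 1 + ε + C₀ + |A₀| := norm_le_of_record hε0 ha₀ hgface hga hgA hgC
  have hν : ‖fderiv ℝ g (A q) (0, 1) - (0, 1)‖ ≤ C₀ + |A₀| + 1 := by
    rw [Prod.norm_def]
    refine max_le ?_ ?_
    · rw [Prod.fst_sub]
      simp only [sub_zero]
      linarith [hgC, abs_nonneg A₀]
    · rw [Prod.snd_sub, Real.norm_eq_abs]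
      have hpos : 0 < (fderiv ℝ g (A q) (0, 1)).2 := ha₀.trans_le hga
      rw [abs_le]; constructor <;> nlinarith [le_abs_self A₀, hgA, abs_nonneg A₀]
  have hMA : ‖fderiv ℝ A q (0, q.2)‖ ≤ MΦ * ‖q.2‖ := by
    rw [hfA_apply]
    exact ((fderiv ℝ Φ (z₁ + q.2)).le_opNorm _).trans (by gcongr)
  have hσ' : |(fderiv ℝ A q (0, q.2)).2| ≤ σ := by rw [hfA_apply]; exact hσ
  have hMA' : ‖fderiv ℝ A' (A q)‖ ≤ MΦ' := by
    refine ContinuousLinearMap.opNorm_le_bound _ hMΦ'0 fun v => ?_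
    rw [hnormA' _ hΦ'₀]
    exact ((fderiv ℝ Φ' (A q)).le_opNorm v).trans (by gcongr)
  have hL'' : ‖fderiv ℝ A' (g (A q)) - fderiv ℝ A' (A q)‖ ≤ L' * ε := by
    refine ContinuousLinearMap.opNorm_le_bound _ (by positivity) fun v => ?_
    have hAq' : fderiv ℝ A' (A q) v = (q.1, fderiv ℝ Φ' (A q) v) := hfA'_apply (A q) hΦ'₀ v
    have e1 : (fderiv ℝ A' (g (A q)) - fderiv ℝ A' (A q)) v =
        (q.1 - q.1, (fderiv ℝ Φ' (g (A q)) - fderiv ℝ Φ' (A q)) v) := by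
      show fderiv ℝ A' (g (A q)) v - fderiv ℝ A' (A q) v =
        (q.1 - q.1, fderiv ℝ Φ' (g (A q)) v - fderiv ℝ Φ' (A q) v)
      rw [hfA'_apply _ hΦ'diff, hAq', Prod.mk_sub_mk]
    rw [e1, ← norm_snd_eq_norm_of_subsingleton]
    exact ((fderiv ℝ Φ' (g (A q)) - fderiv ℝ Φ' (A q)).le_opNorm v).trans (by gcongr)
  have hΔ' : ‖A' (g (A q)) - A' (A q)‖ ≤ MΦ' * ε := by
    simp only [hA', Prod.mk_sub_mk, sub_self]
    rw [← norm_snd_eq_norm_of_subsingleton]; exact hΔ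
  have hη₀' : ‖(fderiv ℝ A' (A q) (fderiv ℝ A q (0, q.2))).2 - ((A' (A q)).2 - z₂)‖ ≤ η₀ * ‖q.2‖ := by
    rw [hfA'_apply _ hΦ'₀, hfA_apply]; exact hη₀
  have hν0 : 0 ≤ C₀ + |A₀| + 1 := by positivity
  have hdef := norm_fderiv_band_sub_le_mul hNev' hAdiff hgdiff (hA'diff _ hΦ'diff) hr hq hη₀' hMA hσ'
    hε0 hν0 hL'0 hMΦ'0 hσ0 hgface hν hGg hMA' hL'' hΔ'
  exact ⟨hsmooth, hfib, hdef⟩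

omit [Subsingleton E] in
/-- **A vertex reads a sector point.** [cite: CampbellDonofrioVitek2026, Lemma 3.2] -/
theorem sectorPoint_readable {G : F → F} {N : E × F → F} {z₁ z₂ : F} {q : E × F}
    (hNev : N =ᶠ[𝓝 q] fun p => G (z₁ + p.2) - z₂) (hG : ContDiffAt ℝ ∞ G (z₁ + q.2))
    (hGz₁ : G z₁ = z₂) {r m κ : ℝ} (hr : ‖q.2‖ ≤ r) (hκ : 0 ≤ κ)
    (hfibG : ∀ w : F, m * ‖w‖ ≤ ‖fderiv ℝ G (z₁ + q.2) w‖)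
    (hdefG : ‖fderiv ℝ G (z₁ + q.2) (z₁ + q.2 - z₁) - (G (z₁ + q.2) - G z₁)‖ ≤ κ * ‖z₁ + q.2 - z₁‖ ^ 2) :
    ContDiffAt ℝ ∞ N q ∧ (∀ w : F, m * ‖w‖ ≤ ‖fderiv ℝ N q (0, w)‖) ∧
      ‖fderiv ℝ N q (0, q.2) - N q‖ ≤ κ * r * ‖q.2‖ := by
  have hshift : HasFDerivAt (fun p : E × F => z₁ + p.2) (ContinuousLinearMap.snd ℝ E F) q :=
    ((ContinuousLinearMap.snd ℝ E F).hasFDerivAt).const_add z₁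
  have h1 : ContDiffAt ℝ ∞ (fun p : E × F => G (z₁ + p.2)) q :=
    hG.comp q (contDiffAt_const.add contDiffAt_snd)
  have hsmooth : ContDiffAt ℝ ∞ N q := (h1.sub contDiffAt_const).congr_of_eventuallyEq hNev
  have hderiv : HasFDerivAt N ((fderiv ℝ G (z₁ + q.2)).comp (ContinuousLinearMap.snd ℝ E F)) q := by
    have h := ((hG.differentiableAt (by simp)).hasFDerivAt.comp q hshift).sub_const z₂
    exact h.congr_of_eventuallyEq hNev
  have hfd : ∀ d : E × F, fderiv ℝ N q d = fderiv ℝ G (z₁ + q.2) d.2 := fun d => by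
    rw [hderiv.fderiv]; rfl
  have hNq : N q = G (z₁ + q.2) - z₂ := hNev.self_of_nhds
  refine ⟨hsmooth, fun w => by rw [hfd]; exact hfibG w, ?_⟩
  rw [hfd, hNq, ← hGz₁]
  simp only [add_sub_cancel_left] at hdefG
  calc ‖fderiv ℝ G (z₁ + q.2) q.2 - (G (z₁ + q.2) - G z₁)‖ ≤ κ * ‖q.2‖ ^ 2 := hdefG
    _ = κ * ‖q.2‖ * ‖q.2‖ := by ring
    _ ≤ κ * r * ‖q.2‖ := by gcongr

end Literature.Topology.FourManifolds
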